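import Literature.Analysis.PDE.QuasilinearHyperbolicUniqueness
import HarnessLib

/-!
# Linear scalar wave equations in lapse–shift–frame variables: the pointwise identities behind
# the symmetric hyperbolic (`A⁰ = 1`) first-order form

Analysis/PDE support file (everything proved; the definitions are explicit differential
expressions) for the fact seat
`provefact-Literature.Geometry.Lorentzian.hawkingEllis_locallyUnique_vacuumDevelopment`
(existence of wave coordinates, Hawking–Ellis 1973, §7.4–7.5: the coordinate functions of a
wave chart solve the linear scalar wave equation `□_g x^a = 0`). A linear second-order operator
on `ℝ × ℝⁿ` with principal part `g^{ab} ∂_a ∂_b`, `g⁰⁰ = −a < 0`, `g^{0j} = a βʲ`,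
`g^{jk} = Q^{jk} − a βʲ βᵏ` (so that `a`, `β`, `Q` are the inverse square lapse, the shift and the
inverse slice metric of the `3+1` form),

  `P f = −a f_tt + 2 a βʲ f_tj + (Q^{jk} − a βʲ βᵏ) f_jk + b_T f_t + b_Xʲ f_j + c f`  (`WaveFrame.P`),

is rewritten in the variables of John's reduction *with a smooth frame* `e_l` of `Q`
(`∑_l e_lʲ e_lᵏ = Q^{jk}`): `D₀ = ∂_t − βʲ ∂_j` (`WaveFrame.D0`), `π̃ = √a · D₀ f`
(`WaveFrame.piT`), `ψ_l = e_lᵏ f_k` (`WaveFrame.psiF`). The two pointwise identities proved here,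

* `WaveFrame.D0_psiF` — `D₀ ψ_l = (√a)⁻¹ e_lᵏ ∂_k π̃ + (D₀ e_lᵏ) f_k + (e_lᵏ ∂_k (√a)⁻¹) π̃
  + e_lᵏ (∂_k βʲ) f_j`,
* `WaveFrame.P_eq` — `P f = −√a D₀ π̃ + √a (D₀ √a) D₀ f − a (D₀ βʲ) f_j + ∑_l e_lʲ ∂_j ψ_l
  − ∑_l e_lʲ (∂_j e_lᵏ) f_k + b_T f_t + b_Xʲ f_j + c f`,

say that for a solution of `P f = 0` the vector `(f, π̃, ψ)` solves a first-order system
`∂_t U = ∑ⱼ Aʲ ∂ⱼ U + B U` whose principal part `Aʲ = βʲ · 1 + (√a)⁻¹ e_lʲ (E_{π̃ψ_l} + E_{ψ_lπ̃})`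
is **symmetric with `A⁰ = 1`** — Friedrichs' format (Friedrichs 1954; John 1982, Ch. 5 §3;
Alinhac 2009, Ex. 7.5 for the wave equation; the frame replaces the square root of the slice
metric used for Kerr–Schild backgrounds in `KerrSchildSymmHypReduction.lean`). Also recorded:
the derivation rules for `D₀` (`D0_fun_mul`, `D0_fun_sum`), the commutator
`D₀ ∂_k f = ∂_k D₀ f + (∂_k βʲ) f_j` (`D0_dX`) and `D₀ D₀ f` in coordinates (`D0_D0`).

## References

* F. John, *Partial differential equations*, 4th ed., Springer 1982, Ch. 5 §3. [John1982]
* S. Alinhac, *Hyperbolic Partial Differential Equations*, Springer 2009, §7.6 Ex. 7.5. [Alinhac2009]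
* S. W. Hawking, G. F. R. Ellis, *The large scale structure of space-time*, CUP 1973, §7.4.
  [HawkingEllis1973CUP]
-/

noncomputable section

open Set Filter
open scoped Topology ContDiff

namespace Literature.Analysis.PDE

namespace WaveFrame

open VarWave

variable {n : ℕ}

/-! ### Derivation rules for `∂_t`, `∂_j` on scalar functions -/

/-- `(g u)_t = g_t u + g u_t`. [folklore] -/
theorem dT_fun_mul {g u : Pt n → ℝ} {p : Pt n} (hg : DifferentiableAt ℝ g p)
    (hu : DifferentiableAt ℝ u p) :
    dT (fun q ↦ g q * u q) p = dT g p * u p + g p * dT u p := by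
  unfold dT
  rw [fderiv_fun_mul hg hu]
  simp only [_root_.add_apply, FunLike.coe_smul, Pi.smul_apply, smul_eq_mul]
  ring

/-- `(g u)_j = g_j u + g u_j`. [folklore] -/
theorem dX_fun_mul {g u : Pt n → ℝ} {p : Pt n} (hg : DifferentiableAt ℝ g p)
    (hu : DifferentiableAt ℝ u p) (j : Fin n) :
    dX (fun q ↦ g q * u q) j p = dX g j p * u p + g p * dX u j p := by
  unfold dX
  rw [fderiv_fun_mul hg hu]
  simp only [_root_.add_apply, FunLike.coe_smul, Pi.smul_apply, smul_eq_mul]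
  ring

/-- `(∑ Fᵢ)_t = ∑ (Fᵢ)_t`. [folklore] -/
theorem dT_fun_sum {ι : Type*} {s : Finset ι} {G : ι → Pt n → ℝ} {p : Pt n}
    (h : ∀ i ∈ s, DifferentiableAt ℝ (G i) p) :
    dT (fun q ↦ ∑ i ∈ s, G i q) p = ∑ i ∈ s, dT (G i) p := by
  unfold dT
  rw [fderiv_fun_sum h]
  simp

/-- `(∑ Fᵢ)_j = ∑ (Fᵢ)_j`. [folklore] -/
theorem dX_fun_sum {ι : Type*} {s : Finset ι} {G : ι → Pt n → ℝ} {p : Pt n}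
    (h : ∀ i ∈ s, DifferentiableAt ℝ (G i) p) (j : Fin n) :
    dX (fun q ↦ ∑ i ∈ s, G i q) j p = ∑ i ∈ s, dX (G i) j p := by
  unfold dX
  rw [fderiv_fun_sum h]
  simp

/-- `(g - u)_t = g_t - u_t`. [folklore] -/
theorem dT_fun_sub {g u : Pt n → ℝ} {p : Pt n} (hg : DifferentiableAt ℝ g p)
    (hu : DifferentiableAt ℝ u p) : dT (fun q ↦ g q - u q) p = dT g p - dT u p := by
  unfold dT
  rw [fderiv_fun_sub hg hu]
  rfl

/-- `(g - u)_j = g_j - u_j`. [folklore] -/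
theorem dX_fun_sub {g u : Pt n → ℝ} {p : Pt n} (hg : DifferentiableAt ℝ g p)
    (hu : DifferentiableAt ℝ u p) (j : Fin n) :
    dX (fun q ↦ g q - u q) j p = dX g j p - dX u j p := by
  unfold dX
  rw [fderiv_fun_sub hg hu]
  rfl

/-- Smooth functions are differentiable (order bookkeeping). [folklore] -/
theorem _root_.ContDiff.differentiableAt_top {f : Pt n → ℝ} (hf : ContDiff ℝ ∞ f) (p : Pt n) :
    DifferentiableAt ℝ f p :=
  (hf.differentiable (by simp)) p

/-! ### The transport derivative `D₀ = ∂_t − βʲ ∂_j` -/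

/-- `D₀ u = u_t − ∑ⱼ βʲ u_j` (the derivative along `∂_t − β`, `N` times the unit normal of the
slices in the `3+1` picture). [cite: John1982, Ch. 5 §3] -/
def D0 (β : Fin n → Pt n → ℝ) (u : Pt n → ℝ) (p : Pt n) : ℝ :=
  dT u p - ∑ j, β j p * dX u j p

variable {β : Fin n → Pt n → ℝ}

/-- `D₀` of a product. [folklore] -/
theorem D0_fun_mul {g u : Pt n → ℝ} {p : Pt n} (hg : DifferentiableAt ℝ g p)
    (hu : DifferentiableAt ℝ u p) :
    D0 β (fun q ↦ g q * u q) p = D0 β g p * u p + g p * D0 β u p := by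
  unfold D0
  rw [dT_fun_mul hg hu]
  simp only [dX_fun_mul hg hu]
  have : ∑ j, β j p * (dX g j p * u p + g p * dX u j p) =
      (∑ j, β j p * dX g j p) * u p + g p * ∑ j, β j p * dX u j p := by
    rw [Finset.sum_mul, Finset.mul_sum, ← Finset.sum_add_distrib]
    exact Finset.sum_congr rfl fun j _ ↦ by ring
  rw [this]
  ring

/-- `D₀` of a finite sum. [folklore] -/
theorem D0_fun_sum {ι : Type*} {s : Finset ι} {G : ι → Pt n → ℝ} {p : Pt n}
    (h : ∀ i ∈ s, DifferentiableAt ℝ (G i) p) :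
    D0 β (fun q ↦ ∑ i ∈ s, G i q) p = ∑ i ∈ s, D0 β (G i) p := by
  unfold D0
  rw [dT_fun_sum (G := G) h]
  simp only [dX_fun_sum (G := G) h, Finset.mul_sum]
  rw [Finset.sum_comm, ← Finset.sum_sub_distrib]

/-- `D₀` is smooth on smooth functions. [folklore] -/
theorem contDiff_D0 (hβ : ∀ j, ContDiff ℝ ∞ (β j)) {u : Pt n → ℝ} (hu : ContDiff ℝ ∞ u) :
    ContDiff ℝ ∞ (D0 β u) := by
  unfold D0
  exact (contDiff_dT hu).sub (ContDiff.sum fun j _ ↦ (hβ j).mul (contDiff_dX hu j))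

/-- **The commutator `[D₀, ∂_k]`**: `D₀ (f_k) = (D₀ f)_k + ∑ⱼ (∂_k βʲ) f_j`. [folklore] -/
theorem D0_dX (hβ : ∀ j, ContDiff ℝ ∞ (β j)) {f : Pt n → ℝ} (hf : ContDiff ℝ ∞ f) (k : Fin n)
    (p : Pt n) :
    D0 β (dX f k) p = dX (D0 β f) k p + ∑ j, dX (β j) k p * dX f j p := by
  have hdf : ∀ j, DifferentiableAt ℝ (dX f j) p := fun j ↦ (contDiff_dX hf j).differentiableAt_top p
  have e1 : D0 β (dX f k) p = dTX f k p - ∑ j, β j p * dXX f j k p := by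
    unfold D0
    rw [show dT (dX f k) p = dTX f k p from fderiv_dX_eT hf k p]
    rfl
  have e2 : dX (D0 β f) k p = dTX f k p - ∑ j, (dX (β j) k p * dX f j p + β j p * dXX f k j p) := by
    unfold D0
    rw [dX_fun_sub (g := dT f) (u := fun q ↦ ∑ j, β j q * dX f j q)
      ((contDiff_dT hf).differentiableAt_top p)
      (DifferentiableAt.fun_sum fun j _ ↦ ((hβ j).differentiableAt_top p).mul (hdf j)),
      dX_fun_sum (G := fun j q ↦ β j q * dX f j q)
        fun j _ ↦ ((hβ j).differentiableAt_top p).mul (hdf j)]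
    simp only [dX_fun_mul ((hβ _).differentiableAt_top p) (hdf _)]
    rfl
  rw [e1, e2]
  simp only [Finset.sum_add_distrib, dXX_comm hf k]
  ring

/-- **`D₀ D₀ f` in coordinates**:
`D₀ D₀ f = f_tt − 2 βʲ f_tj + βʲ βᵏ f_jk − (D₀ βʲ) f_j`. [cite: John1982, Ch. 5 §3] -/
theorem D0_D0 (hβ : ∀ j, ContDiff ℝ ∞ (β j)) {f : Pt n → ℝ} (hf : ContDiff ℝ ∞ f) (p : Pt n) :
    D0 β (D0 β f) p = dTT f p - 2 * ∑ j, β j p * dTX f j p +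
      ∑ j, ∑ k, β j p * β k p * dXX f j k p - ∑ j, D0 β (β j) p * dX f j p := by
  have hdf : ∀ j, DifferentiableAt ℝ (dX f j) p := fun j ↦ (contDiff_dX hf j).differentiableAt_top p
  have hdT : DifferentiableAt ℝ (dT f) p := (contDiff_dT hf).differentiableAt_top p
  have hprod : ∀ j, DifferentiableAt ℝ (fun q ↦ β j q * dX f j q) p := fun j ↦
    ((hβ j).differentiableAt_top p).mul (hdf j)
  -- `D₀ (D₀ f) = D₀ f_t − ∑ⱼ D₀ (βʲ f_j)`
  have e0 : D0 β (D0 β f) p = D0 β (dT f) p - ∑ j, D0 β (fun q ↦ β j q * dX f j q) p := by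
    have : D0 β f = fun q ↦ dT f q - ∑ j, β j q * dX f j q := rfl
    rw [this]
    unfold D0
    rw [dT_fun_sub (g := dT f) (u := fun q ↦ ∑ j, β j q * dX f j q) hdT
        (DifferentiableAt.fun_sum fun j _ ↦ hprod j),
      dT_fun_sum (G := fun j q ↦ β j q * dX f j q) fun j _ ↦ hprod j]
    simp only [dX_fun_sub (g := dT f) (u := fun q ↦ ∑ j, β j q * dX f j q) hdT
        (DifferentiableAt.fun_sum fun j _ ↦ hprod j),
      dX_fun_sum (G := fun j q ↦ β j q * dX f j q) (fun j _ ↦ hprod j)]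
    simp only [mul_sub, Finset.sum_sub_distrib, Finset.mul_sum]
    rw [Finset.sum_comm (f := fun x y ↦ β x p * dX (fun q ↦ β y q * dX f y q) x p)]
    ring
  -- `D₀ f_t = f_tt − ∑ βʲ f_tj`
  have e1 : D0 β (dT f) p = dTT f p - ∑ j, β j p * dTX f j p := rfl
  -- `D₀ (βʲ f_j) = (D₀ βʲ) f_j + βʲ (f_tj − ∑ₖ βᵏ f_kj)`
  have e2 : ∀ j, D0 β (fun q ↦ β j q * dX f j q) p =
      D0 β (β j) p * dX f j p + β j p * (dTX f j p - ∑ k, β k p * dXX f k j p) := fun j ↦ by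
    rw [D0_fun_mul ((hβ j).differentiableAt_top p) (hdf j)]
    congr 1
    unfold D0
    rw [show dT (dX f j) p = dTX f j p from fderiv_dX_eT hf j p]
    rfl
  rw [e0, e1, Finset.sum_congr rfl fun j _ ↦ e2 j]
  have e3 : ∑ j, (D0 β (β j) p * dX f j p + β j p * (dTX f j p - ∑ k, β k p * dXX f k j p)) =
      ∑ j, D0 β (β j) p * dX f j p + ∑ j, β j p * dTX f j p -
        ∑ j, ∑ k, β j p * β k p * dXX f j k p := by
    rw [← Finset.sum_add_distrib, ← Finset.sum_sub_distrib]
    refine Finset.sum_congr rfl fun j _ ↦ ?_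
    rw [mul_sub, Finset.mul_sum]
    simp only [dXX_comm hf _ j]
    have : ∑ k, β j p * (β k p * dXX f j k p) = ∑ k, β j p * β k p * dXX f j k p :=
      Finset.sum_congr rfl fun k _ ↦ by ring
    rw [this]
    ring
  rw [e3]
  ring

/-! ### The variables `π̃ = √a D₀ f`, `ψ_l = e_lᵏ f_k` -/

variable {a : Pt n → ℝ} {e : Fin n → Fin n → Pt n → ℝ}

/-- `π̃ = √a · D₀ f` (`= D₀ f / N`, `N = a^{-1/2}` the lapse). [cite: John1982, Ch. 5 §3] -/
def piT (a : Pt n → ℝ) (β : Fin n → Pt n → ℝ) (f : Pt n → ℝ) (q : Pt n) : ℝ :=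
  Real.sqrt (a q) * D0 β f q

/-- `ψ_l = ∑ₖ e_lᵏ f_k` (the frame components of the spatial gradient). [cite: John1982, Ch. 5 §3] -/
def psiF (e : Fin n → Fin n → Pt n → ℝ) (f : Pt n → ℝ) (l : Fin n) (q : Pt n) : ℝ :=
  ∑ k, e l k q * dX f k q

/-- `√a` is smooth where `a > 0`. [folklore] -/
theorem contDiff_sqrt_coef (ha : ContDiff ℝ ∞ a) (hapos : ∀ q, 0 < a q) :
    ContDiff ℝ ∞ fun q ↦ Real.sqrt (a q) :=
  ha.sqrt fun q ↦ (hapos q).ne'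

/-- `(√a)⁻¹` is smooth where `a > 0`. [folklore] -/
theorem contDiff_inv_sqrt_coef (ha : ContDiff ℝ ∞ a) (hapos : ∀ q, 0 < a q) :
    ContDiff ℝ ∞ fun q ↦ (Real.sqrt (a q))⁻¹ :=
  (contDiff_sqrt_coef ha hapos).inv fun q ↦ (Real.sqrt_pos.2 (hapos q)).ne'

/-- `π̃` is smooth. [folklore] -/
theorem contDiff_piT (ha : ContDiff ℝ ∞ a) (hapos : ∀ q, 0 < a q) (hβ : ∀ j, ContDiff ℝ ∞ (β j))
    {f : Pt n → ℝ} (hf : ContDiff ℝ ∞ f) : ContDiff ℝ ∞ (piT a β f) :=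
  (contDiff_sqrt_coef ha hapos).mul (contDiff_D0 hβ hf)

/-- `ψ_l` is smooth. [folklore] -/
theorem contDiff_psiF (he : ∀ l k, ContDiff ℝ ∞ (e l k)) {f : Pt n → ℝ} (hf : ContDiff ℝ ∞ f)
    (l : Fin n) : ContDiff ℝ ∞ (psiF e f l) :=
  ContDiff.sum fun k _ ↦ (he l k).mul (contDiff_dX hf k)

/-- `D₀ f = (√a)⁻¹ π̃`. [folklore] -/
theorem D0_eq_inv_sqrt_mul_piT (hapos : ∀ q, 0 < a q) (f : Pt n → ℝ) (q : Pt n) :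
    D0 β f q = (Real.sqrt (a q))⁻¹ * piT a β f q := by
  unfold piT
  rw [← mul_assoc, inv_mul_cancel₀ (Real.sqrt_pos.2 (hapos q)).ne', one_mul]

/-- **The `ψ`-equation**: `D₀ ψ_l = (√a)⁻¹ ∑ₖ e_lᵏ ∂_k π̃ + ∑ₖ (D₀ e_lᵏ) f_k
+ (∑ₖ e_lᵏ ∂_k (√a)⁻¹) π̃ + ∑ₖ e_lᵏ ∑ⱼ (∂_k βʲ) f_j`. [cite: John1982, Ch. 5 §3] -/
theorem D0_psiF (ha : ContDiff ℝ ∞ a) (hapos : ∀ q, 0 < a q) (hβ : ∀ j, ContDiff ℝ ∞ (β j))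
    (he : ∀ l k, ContDiff ℝ ∞ (e l k)) {f : Pt n → ℝ} (hf : ContDiff ℝ ∞ f) (l : Fin n) (p : Pt n) :
    D0 β (psiF e f l) p =
      (Real.sqrt (a p))⁻¹ * ∑ k, e l k p * dX (piT a β f) k p +
        ∑ k, D0 β (e l k) p * dX f k p +
        (∑ k, e l k p * dX (fun q ↦ (Real.sqrt (a q))⁻¹) k p) * piT a β f p +
        ∑ k, e l k p * ∑ j, dX (β j) k p * dX f j p := by
  have hdf : ∀ j, DifferentiableAt ℝ (dX f j) p := fun j ↦ (contDiff_dX hf j).differentiableAt_top p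
  have hs : DifferentiableAt ℝ (fun q ↦ (Real.sqrt (a q))⁻¹) p :=
    (contDiff_inv_sqrt_coef ha hapos).differentiableAt_top p
  have hpi : DifferentiableAt ℝ (piT a β f) p := (contDiff_piT ha hapos hβ hf).differentiableAt_top p
  -- `D₀ ψ_l = ∑ₖ (D₀ e_lᵏ) f_k + e_lᵏ D₀ f_k`
  have e0 : D0 β (psiF e f l) p = ∑ k, (D0 β (e l k) p * dX f k p + e l k p * D0 β (dX f k) p) := by
    unfold psiF
    rw [D0_fun_sum (G := fun k q ↦ e l k q * dX f k q)
      fun k _ ↦ ((he l k).differentiableAt_top p).mul (hdf k)]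
    exact Finset.sum_congr rfl fun k _ ↦ D0_fun_mul ((he l k).differentiableAt_top p) (hdf k)
  -- `D₀ f_k = ∂_k ((√a)⁻¹ π̃) + ∑ⱼ (∂_k βʲ) f_j`
  have e1 : ∀ k, D0 β (dX f k) p = dX (fun q ↦ (Real.sqrt (a q))⁻¹) k p * piT a β f p +
      (Real.sqrt (a p))⁻¹ * dX (piT a β f) k p + ∑ j, dX (β j) k p * dX f j p := fun k ↦ by
    rw [D0_dX hβ hf k p]
    have : D0 β f = fun q ↦ (Real.sqrt (a q))⁻¹ * piT a β f q :=
      funext fun q ↦ D0_eq_inv_sqrt_mul_piT hapos f q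
    rw [this, dX_fun_mul hs hpi]
  rw [e0]
  simp only [e1, mul_add, Finset.sum_add_distrib, Finset.mul_sum, Finset.sum_mul]
  have h1 : ∑ k, e l k p * ((Real.sqrt (a p))⁻¹ * dX (piT a β f) k p) =
      ∑ k, (Real.sqrt (a p))⁻¹ * (e l k p * dX (piT a β f) k p) :=
    Finset.sum_congr rfl fun k _ ↦ by ring
  have h2 : ∑ k, e l k p * (dX (fun q ↦ (Real.sqrt (a q))⁻¹) k p * piT a β f p) =
      ∑ k, e l k p * dX (fun q ↦ (Real.sqrt (a q))⁻¹) k p * piT a β f p :=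
    Finset.sum_congr rfl fun k _ ↦ by ring
  rw [h1, h2]
  ring

/-! ### The operator and its frame form -/

/-- **The linear wave operator in `3+1`–inverse-metric form**:
`P f = −a f_tt + 2 a βʲ f_tj + (Q^{jk} − a βʲβᵏ) f_jk + b_T f_t + b_Xʲ f_j + c f`
(`= g^{ab}∂_a∂_b f + …` with `g⁰⁰ = −a`, `g^{0j} = aβʲ`, `g^{jk} = Q^{jk} − aβʲβᵏ`).
[cite: John1982, Ch. 5 §3] -/
def P (a : Pt n → ℝ) (β : Fin n → Pt n → ℝ) (Q : Fin n → Fin n → Pt n → ℝ) (bT : Pt n → ℝ)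
    (bX : Fin n → Pt n → ℝ) (c : Pt n → ℝ) (f : Pt n → ℝ) (p : Pt n) : ℝ :=
  -a p * dTT f p + 2 * ∑ j, a p * β j p * dTX f j p +
    ∑ j, ∑ k, (Q j k p - a p * β j p * β k p) * dXX f j k p +
    bT p * dT f p + ∑ j, bX j p * dX f j p + c p * f p

variable {Q : Fin n → Fin n → Pt n → ℝ} {bT c : Pt n → ℝ} {bX : Fin n → Pt n → ℝ}

/-- **The frame identity for the second-order spatial part**:
`∑_{jk} Q^{jk} f_jk = ∑_l e_lʲ ∂_j ψ_l − ∑_l e_lʲ (∂_j e_lᵏ) f_k` when `∑_l e_lʲ e_lᵏ = Q^{jk}`.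
[folklore] -/
theorem sum_Q_dXX_eq (he : ∀ l k, ContDiff ℝ ∞ (e l k))
    (hQ : ∀ j k q, ∑ l, e l j q * e l k q = Q j k q) {f : Pt n → ℝ} (hf : ContDiff ℝ ∞ f)
    (p : Pt n) :
    ∑ j, ∑ k, Q j k p * dXX f j k p =
      ∑ l, ∑ j, e l j p * dX (psiF e f l) j p -
        ∑ l, ∑ j, ∑ k, e l j p * dX (e l k) j p * dX f k p := by
  have hdf : ∀ j, DifferentiableAt ℝ (dX f j) p := fun j ↦ (contDiff_dX hf j).differentiableAt_top p
  have e1 : ∀ l j, dX (psiF e f l) j p = ∑ k, (dX (e l k) j p * dX f k p + e l k p * dXX f j k p) :=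
    fun l j ↦ by
    unfold psiF
    rw [dX_fun_sum (G := fun k q ↦ e l k q * dX f k q)
      fun k _ ↦ ((he l k).differentiableAt_top p).mul (hdf k)]
    exact Finset.sum_congr rfl fun k _ ↦ by
      rw [dX_fun_mul ((he l k).differentiableAt_top p) (hdf k)]
      rfl
  simp only [e1, Finset.mul_sum, mul_add, Finset.sum_add_distrib]
  have e2 : ∑ j, ∑ k, Q j k p * dXX f j k p = ∑ j, ∑ k, ∑ l, e l j p * e l k p * dXX f j k p := by
    refine Finset.sum_congr rfl fun j _ ↦ Finset.sum_congr rfl fun k _ ↦ ?_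
    rw [← hQ j k p, Finset.sum_mul]
  rw [e2]
  have e3 : ∑ l, ∑ j, ∑ k, e l j p * (e l k p * dXX f j k p) =
      ∑ j, ∑ k, ∑ l, e l j p * e l k p * dXX f j k p := by
    rw [Finset.sum_comm]
    refine Finset.sum_congr rfl fun j _ ↦ ?_
    rw [Finset.sum_comm]
    exact Finset.sum_congr rfl fun k _ ↦ Finset.sum_congr rfl fun l _ ↦ by ring
  have e4 : ∑ l, ∑ j, ∑ k, e l j p * (dX (e l k) j p * dX f k p) =
      ∑ l, ∑ j, ∑ k, e l j p * dX (e l k) j p * dX f k p :=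
    Finset.sum_congr rfl fun l _ ↦ Finset.sum_congr rfl fun j _ ↦
      Finset.sum_congr rfl fun k _ ↦ by ring
  rw [e3, e4]
  ring

/-- **`D₀ π̃` through `D₀ D₀ f`**: `√a D₀ π̃ = a D₀D₀ f + √a (D₀ √a) D₀ f`. [folklore] -/
theorem sqrt_mul_D0_piT (ha : ContDiff ℝ ∞ a) (hapos : ∀ q, 0 < a q)
    (hβ : ∀ j, ContDiff ℝ ∞ (β j)) {f : Pt n → ℝ} (hf : ContDiff ℝ ∞ f) (p : Pt n) :
    Real.sqrt (a p) * D0 β (piT a β f) p =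
      a p * D0 β (D0 β f) p + Real.sqrt (a p) * D0 β (fun q ↦ Real.sqrt (a q)) p * D0 β f p := by
  unfold piT
  rw [D0_fun_mul ((contDiff_sqrt_coef ha hapos).differentiableAt_top p)
    ((contDiff_D0 hβ hf).differentiableAt_top p)]
  have hsq : Real.sqrt (a p) * Real.sqrt (a p) = a p := Real.mul_self_sqrt (hapos p).le
  rw [mul_add, show Real.sqrt (a p) * (Real.sqrt (a p) * D0 β (D0 β f) p) = a p * D0 β (D0 β f) p by
    rw [← mul_assoc, hsq]]
  ring

/-- **The wave operator in frame variables**: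
`P f = −√a D₀ π̃ + √a (D₀ √a) D₀ f − a ∑ⱼ (D₀ βʲ) f_j + ∑_l e_lʲ ∂_j ψ_l − ∑_l e_lʲ (∂_j e_lᵏ) f_k
+ b_T f_t + b_Xʲ f_j + c f`. In particular a solution of `P f = 0` gives a solution
`(f, π̃, ψ)` of the symmetric first-order system. [cite: John1982, Ch. 5 §3] -/
theorem P_eq (ha : ContDiff ℝ ∞ a) (hapos : ∀ q, 0 < a q) (hβ : ∀ j, ContDiff ℝ ∞ (β j))
    (he : ∀ l k, ContDiff ℝ ∞ (e l k)) (hQ : ∀ j k q, ∑ l, e l j q * e l k q = Q j k q)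
    {f : Pt n → ℝ} (hf : ContDiff ℝ ∞ f) (p : Pt n) :
    P a β Q bT bX c f p =
      -(Real.sqrt (a p) * D0 β (piT a β f) p) +
        Real.sqrt (a p) * D0 β (fun q ↦ Real.sqrt (a q)) p * D0 β f p -
        a p * ∑ j, D0 β (β j) p * dX f j p +
        ∑ l, ∑ j, e l j p * dX (psiF e f l) j p -
        ∑ l, ∑ j, ∑ k, e l j p * dX (e l k) j p * dX f k p +
        bT p * dT f p + ∑ j, bX j p * dX f j p + c p * f p := by
  rw [sqrt_mul_D0_piT ha hapos hβ hf p, D0_D0 hβ hf p]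
  unfold P
  have e1 : ∑ j, ∑ k, (Q j k p - a p * β j p * β k p) * dXX f j k p =
      ∑ j, ∑ k, Q j k p * dXX f j k p - a p * ∑ j, ∑ k, β j p * β k p * dXX f j k p := by
    simp only [sub_mul, Finset.sum_sub_distrib, Finset.mul_sum]
    congr 1
    exact Finset.sum_congr rfl fun j _ ↦ Finset.sum_congr rfl fun k _ ↦ by ring
  rw [e1, sum_Q_dXX_eq he hQ hf p]
  have e2 : ∑ j, a p * β j p * dTX f j p = a p * ∑ j, β j p * dTX f j p := by
    rw [Finset.mul_sum]
    exact Finset.sum_congr rfl fun j _ ↦ by ring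
  rw [e2]
  ring

end WaveFrame

end Literature.Analysis.PDE
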